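import Summits.NavierStokesRegularity.NavierStokesRegularity.Theorems.FilamentSkeletonRssKelvinGateSmoothing
import Summits.NavierStokesRegularity.NavierStokesRegularity.Theorems.FilamentSkeletonRssKelvinGateDefs
import HarnessLib.Audit

/-!
# Line `free_rate_gate` for the crux `FilamentSkeletonRss.TransverseReduction1A` (stmt-NavierStokesRegularity-27414)

Registered by the crux-strategist seat `cstrat-stmt-NavierStokesRegularity-21221` (2026-08-28).  The strategist payload named
the predecessor crux `TransverseReductionRJ` (stmt-21221), which the tenure planner turned into an ASIDE at route rev 14–16
(R-T/R-μ retype, Variant A1α, 2026-08-28T10:16Z); its mathematical content — the transverse reduction — now lives in the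
successor crux `TransverseReduction1A` (stmt-27414, "cut plan-only", no registered line before this file).  This line is the
FREE-RATE re-threading of the predecessor's line `kelvin_gate` v4 (`Cruxes/TransverseReductionRJ/Lines/kelvin_gate.lean`):
ONE skeleton instead of a box, the core-MATCHED kernel of `SkeletonJ1`, NO torque/accretion modes `D_pj`, NO multipliers —
and the ONE symmetry direction that needs a parameter (the `e₃`-rotation cokernel, kit `retype_R-T_kit.md` §10.1) is funded
by the FREE RATE `α₁`, carried through the line as a Lyapunov–Schmidt unknown: the linear step is the BORDERED operator
`(W, Q, b) ↦ 𝓛_(α′,U⁰) W + ∇Q + b·𝓡U⁰` (rate column `𝓡U⁰ = e₃×U⁰ − DU⁰·(e₃×y) = ∂_α E_α(U⁰)` in place of span{D_pj}),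
demanded for every rate `α′` in the window `|α′ − α⁰| ≤ θ₀/4` around the base rate, and the closing solves
`E_(α⁰+β)(U⁰+W) + ∇(P⁰+Q) = 0` in the unknowns `(W, β)`: a contraction in `W` at each frozen rate and a one-dimensional
intermediate-value selection of `β = 𝓫_(α⁰+β)(G_β)` (the rate interval is the "box", `p ↦ α′`; `β·𝓡W` has only X-decay, never
Y-decay, so the rate shift MUST sit in the linear operator — the resolvent is only log-Lipschitz in the rate as a map Y → X, which is
why the gate carries local rate-continuity + tightness clauses exactly as `kelvin_gate`'s `GateSpec` carried them in `p`).

HONEST FRAMING.  Bookkeeping for a HYPOTHETICAL filament-type rotating-self-similar (RSS) blow-up route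
(`route-NavierStokesRegularity-FilamentSkeletonRss`, refutation side: `closes … : ¬ NavierStokesRegularity`).  Nothing in this
file moves Navier–Stokes regularity; the three stubs below are OPEN, S2′ is expected to be as hard as anything on the route.

THE CRUX (verbatim cut in §1, certified by `transverseReduction1A_iff := Iff.rfl`): for all box constants there is `Γ₁` such that
for `Γ ≥ Γ₁` and every skeleton `(γ, α, X, w, c, m, n, Aa)` satisfying the `SkeletonJ1` clauses there are `α₁ ≠ 0`, `C₀`, `M`, a
smooth divergence-free `U ≠ 0` and a smooth `P` solving the rotating Leray profile equation EXACTLY at rate `α₁`, with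
`|U| ≤ C₀/(1+|y|)`, `|P| ≤ M`, `η√Γ`-close to the skeleton field on the waist ball off the tubes.

THE LINE (3 registered stubs + 1 landed theorem):
* S1′ `Dressing1A` (XL) — matched-asymptotics dressing of ONE skeleton to any order `k`, with a BASE RATE `α⁰`,
  `|α⁰ − α| ≤ θ₀/4` (the rotation cokernel of the linearised skeleton map is one-dimensional, so higher-order solvability
  fixes the rate order by order — Gallay–Šverák fix the ring speed the same way): spec `BaseSpec1`.
* S2′ `BorderedGate1A` (XL; KILL-FIRST, hardest) — around every dressed base of sufficiently high order the BORDERED linearised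
  operator has a right inverse `(𝓚_α′, 𝓠_α′, 𝓫_α′)` for all rates `|α′ − α⁰| ≤ θ₀/4`, linear, with POLYNOMIAL bound `C₂Γ^κ`
  (Y-scale forcing → X-scale velocity, bounded pressure, bounded rate coefficient), tight, locally continuous in the rate:
  spec `GateSpec1A`.  Physics: outer zone = landed free resolvent (`Theorems.KelvinGate.free_resolvent`, α-UNIFORM) + Neumann;
  tubes = fast-rotation-enhanced 2D sector (Gallay–Maekawa skew structure, Γ-uniform) ⊕ slow filament sector (m = 0, ±1 long
  waves) controlled by clauses 10–13J; the Kelvin m = ±1 resonance with the frame rotation sits at axial wavenumber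
  `k√Γ ~ 1`, i.e. AT the skeleton scale, where clause 13-J is exactly the no-resonance statement; core-scale (`k ~ 1`) strain–Kelvin-pair
  (elliptic) resonances have Γ-free growth but bandwidth `O(Γ⁻¹)` in `k` and are swept by the waist stretching `w′ ≥ 3/2+δ` of clause 10 — the gate
  USES the stretching floor at core scale too; the residual risk is a PINNED resonance of the Γ → ∞ waist operator (line card §Hardest stub, zones
  Z0–Z3; crux idea `waist-wall`).
* S3′ `RateClosing1A` (L) — frozen-rate contraction + IVT in `β`; delivers the conclusion with `C²/C¹` regularity (`AlmostConcl1A`).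
* S4′ is NOT a stub: `Theorems.KelvinGate.Smoothing.contDiff_velocity_infty / contDiff_pressure_infty` (landed, forcing `F = 0`)
  upgrade `C²/C¹` to `C^∞` inside `lineGlue1A`.
* `lineGlue1A : S1′ → S2′ → S3′ → CutForm1A` is PROVED below (pure logic + the landed smoothing, no sorry) and
  `TransverseReduction1A_of : TransverseReduction1A` (A12 shape, no hypotheses) exhibits the crux BY NAME from the three `stub_*`.

`lean check`: rc 0, sorries = 3 (only `stub_*`); target `…Theses.FilamentSkeletonRss.TransverseReduction1A` BY NAME.
-/

set_option linter.dupNamespace false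

noncomputable section

namespace Summit.NavierStokesRegularity.NavierStokesRegularity.Cruxes.TransverseReduction1A.FreeRateGate

open scoped BigOperators Topology Manifold Classical MeasureTheory ProbabilityTheory Matrix InnerProductSpace ComplexConjugate ContinuousMap ENNReal ContDiff
open Filter Set Function TopologicalSpace MeasureTheory
open Literature.NS
open Literature.Analysis.FluidPDE
open Summit.NavierStokesRegularity.NavierStokesRegularity.Theses.FilamentSkeletonRss
open Summit.NavierStokesRegularity.NavierStokesRegularity.Theorems.KelvinGate (lerayOp lerayLin XBound YBound LocClose)


/-! ## 1. The crux, cut at its arrows (texts VERBATIM from the route decl `TransverseReduction1A`, l.435 of the route file) -/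

/-- Defining hypothesis 1 (core-MATCHED regularised Biot–Savart field of a filament configuration `Z` with core areas `Aa`). -/
def DefU1 (N : ℕ) (Γ : ℝ) (γ : Fin N → ℝ) (Aa : Fin N → ℝ → ℝ) (u : (Fin N → ℝ → EuclideanSpace ℝ (Fin 3)) → EuclideanSpace ℝ (Fin 3) → EuclideanSpace ℝ (Fin 3)) : Prop :=
  ∀ Z y, u Z y = ∑ k, (Γ*γ k/(4*Real.pi))•∫ σ:ℝ, ((‖y-Z k σ‖^2+Real.exp (-(1+Real.eulerMascheroniConstant-Real.log 2))*Aa k σ)^(3/2:ℝ))⁻¹•cross (deriv (Z k) σ) (y-Z k σ)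

/-- Defining hypothesis 2 (frame field `v = u_X + ½y − α e₃×y`). -/
def DefV1 (N : ℕ) (α : ℝ) (X : Fin N → ℝ → EuclideanSpace ℝ (Fin 3)) (u : (Fin N → ℝ → EuclideanSpace ℝ (Fin 3)) → EuclideanSpace ℝ (Fin 3) → EuclideanSpace ℝ (Fin 3)) (v : EuclideanSpace ℝ (Fin 3) → EuclideanSpace ℝ (Fin 3)) : Prop :=
  ∀ y, v y = u X y+(1/2:ℝ)•y-α•cross (EuclideanSpace.single 2 1) y

/-- Defining hypothesis 3 (velocity gradient at the stagnation points). -/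
def DefA1 (N : ℕ) (X : Fin N → ℝ → EuclideanSpace ℝ (Fin 3)) (c : Fin N → ℝ) (v : EuclideanSpace ℝ (Fin 3) → EuclideanSpace ℝ (Fin 3)) (A : Fin N → (EuclideanSpace ℝ (Fin 3) →L[ℝ] EuclideanSpace ℝ (Fin 3))) : Prop :=
  ∀ j, A j = fderiv ℝ v (X j (c j))

/-- Defining hypothesis 4 (normal part of the frame velocity along a configuration: the filament-equilibrium map `T`). -/
def DefT1 (N : ℕ) (α : ℝ) (u : (Fin N → ℝ → EuclideanSpace ℝ (Fin 3)) → EuclideanSpace ℝ (Fin 3) → EuclideanSpace ℝ (Fin 3)) (T : (Fin N → ℝ → EuclideanSpace ℝ (Fin 3)) → Fin N → ℝ → EuclideanSpace ℝ (Fin 3)) : Prop :=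
  ∀ Z j τ, T Z j τ = (u Z (Z j τ)+(1/2:ℝ)•Z j τ-α•cross (EuclideanSpace.single 2 1) (Z j τ))-(⟪u Z (Z j τ)+(1/2:ℝ)•Z j τ-α•cross (EuclideanSpace.single 2 1) (Z j τ), deriv (Z j) τ⟫_ℝ/‖deriv (Z j) τ‖^2)•deriv (Z j) τ

/-- The `SkeletonJ1` clause block of the crux's hypothesis (clauses 1–13J + the core-area law), VERBATIM. -/
def Clauses1 (N : ℕ) (Γ δ ρ K Λ a b cnd Rw Rb cg θ₀ : ℝ) (γ : Fin N → ℝ) (α : ℝ) (X : Fin N → ℝ → EuclideanSpace ℝ (Fin 3)) (w : Fin N → ℝ → ℝ) (c : Fin N → ℝ) (m n : Fin N → EuclideanSpace ℝ (Fin 3)) (Aa : Fin N → ℝ → ℝ) (v : EuclideanSpace ℝ (Fin 3) → EuclideanSpace ℝ (Fin 3)) (A : Fin N → (EuclideanSpace ℝ (Fin 3) →L[ℝ] EuclideanSpace ℝ (Fin 3))) (T : (Fin N → ℝ → EuclideanSpace ℝ (Fin 3)) → Fin N → ℝ → EuclideanSpace ℝ (Fin 3)) : Prop :=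
  (α ≠ 0 ∧ (∀ j, γ j ≠ 0)∧(∀ j, ContDiff ℝ 2 (X j) ∧ Differentiable ℝ (w j)∧(∀ τ, ‖deriv (X j) τ‖ = 1)∧(∀ τ, ‖iteratedDeriv 2 (X j) τ‖*√Γ≤K) ∧ Tendsto (fun τ => ‖X j τ‖) (cocompact ℝ) atTop)∧(∀ j k, j ≠ k → ∀ τ σ, ρ*√Γ≤‖X j τ-X k σ‖)∧(∀ j τ σ, ρ*√Γ≤|τ-σ| → cg*ρ*√Γ≤‖X j τ-X j σ‖)∧(∀ j τ, cg*|τ-c j|≤Rw*√Γ+‖X j τ‖)∧(∀ j τ, w j τ = ⟪v (X j τ), deriv (X j) τ⟫_ℝ)∧(∀ j τ, ‖X j τ‖≤Rb*√(Γ*Real.log Γ) → v (X j τ) = w j τ•deriv (X j) τ)∧(∀ j, ‖X j (c j)‖≤Rw*√Γ)∧(∀ j, |⟪deriv (X j) (c j), EuclideanSpace.single 2 1⟫_ℝ|≤1-θ₀)∧(θ₀≤|α| ∧ |α|≤θ₀⁻¹ ∧ ∀ j, θ₀≤|γ j| ∧ |γ j|≤θ₀⁻¹)∧(∀ j, w j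 (c j) = 0 ∧ (∀ τ, w j τ = 0 → τ = c j) ∧ 3/2+δ≤deriv (w j) (c j) ∧ deriv (w j) (c j)≤Λ)∧(∀ j, Differentiable ℝ (Aa j) ∧ (∀ τ, 0 < Aa j τ) ∧ ∀ τ, w j τ*deriv (Aa j) τ = (3/2-deriv (w j) τ)*Aa j τ+4)∧(∀ j, Orthonormal ℝ ![deriv (X j) (c j), m j, n j] ∧ ⟪A j (m j), m j⟫_ℝ+⟪A j (n j), n j⟫_ℝ < 0 ∧ ⟪A j (n j), m j⟫_ℝ * ⟪A j (m j), n j⟫_ℝ < ⟪A j (m j), m j⟫_ℝ * ⟪A j (n j), n j⟫_ℝ)∧(∀ Y:Fin N → ℝ → EuclideanSpace ℝ (Fin 3), (∀ j, ContDiff ℝ 2 (Y j))→(∀ j τ, ⟪Y j τ, deriv (X j) τ⟫_ℝ = 0) → (∀ j τ, Rb*√(Γ*Real.log Γ) < ‖X j τ‖ → Y j τ = 0) → ∑ j, ⟪Y j (c j), cross (EuclideanSpace.single 2 1) (X j (c j))⟫_ℝ = 0 → (∀ j τ, ‖Y j τ‖+‖deriv (Y j) τ‖+‖iteratedDeriv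 2 (Y j) τ‖≤(1+|τ-c j|)^b) → ∀ L:ℝ, (∀ j τ, ‖deriv (fun s:ℝ => T (fun k σ => X k σ+s•Y k σ) j τ) 0‖≤L*(1+|τ-c j|)^a) → ∀ j τ, ‖Y j τ‖≤cnd*L*(1+|τ-c j|)^b))

/-- The crux's conclusion block for a candidate `(α₁, C₀, M, U, P)`, VERBATIM. -/
def Concl1 (N : ℕ) (Γ ρ η Rw : ℝ) (X : Fin N → ℝ → EuclideanSpace ℝ (Fin 3)) (u : (Fin N → ℝ → EuclideanSpace ℝ (Fin 3)) → EuclideanSpace ℝ (Fin 3) → EuclideanSpace ℝ (Fin 3)) (α₁ C₀ M : ℝ) (U : EuclideanSpace ℝ (Fin 3) → EuclideanSpace ℝ (Fin 3)) (P : EuclideanSpace ℝ (Fin 3) → ℝ) : Prop :=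
  α₁ ≠ 0 ∧ U ≠ 0 ∧ ContDiff ℝ (⊤:ℕ∞) U ∧ ContDiff ℝ (⊤:ℕ∞) P ∧ VectorCalculus.IsDivFree U∧(∀ y, α₁•(cross (EuclideanSpace.single 2 1) (U y)-fderiv ℝ U y (cross (EuclideanSpace.single 2 1) y))+(1/2:ℝ)•U y+(1/2:ℝ)•fderiv ℝ U y y-(Laplacian.laplacian U) y+fderiv ℝ U y (U y)+gradient P y = 0)∧(∀ y, ‖U y‖≤C₀/(1+‖y‖))∧(∀ y, |P y|≤M)∧(∀ y, ‖y‖≤Rw*√Γ → (∀ j τ, ρ*√Γ/4≤‖y-X j τ‖) → ‖U y-u X y‖≤η*√Γ)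

/-- The CUT FORM of the crux: hypotheses `DefU1 … Clauses1`, conclusion `Concl1` (an `abbrev`, so that the line's glue theorem
concludes THIS constant and only `TransverseReduction1A_of` below concludes the crux by name — skeleton A12 shape). -/
abbrev CutForm1A : Prop :=
    ∀ (N : ℕ) (δ ρ K Λ a b cnd η Rw Rb cg θ₀ : ℝ), 0 < N → 0 < δ → 0 < ρ → 0 ≤ a → 0 < η → 0 < Rw → 0 < Rb → 0 < cg → 0 < θ₀ → ∃ Γ₁ : ℝ, ∀ Γ : ℝ, Γ₁ ≤ Γ → ∀ (γ : Fin N → ℝ) (α : ℝ) (X : Fin N → ℝ → EuclideanSpace ℝ (Fin 3)) (w : Fin N → ℝ → ℝ) (c : Fin N → ℝ) (m n : Fin N → EuclideanSpace ℝ (Fin 3)) (Aa : Fin N → ℝ → ℝ) (u : (Fin N → ℝ → EuclideanSpace ℝ (Fin 3)) → EuclideanSpace ℝ (Fin 3) → EuclideanSpace ℝ (Fin 3)) (v : EuclideanSpace ℝ (Fin 3) → EuclideanSpace ℝ (Fin 3)) (A : Fin N → (EuclideanSpace ℝ (Fin 3) →L[ℝ] EuclideanSpace ℝ (Fin 3)))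 (T : (Fin N → ℝ → EuclideanSpace ℝ (Fin 3)) → Fin N → ℝ → EuclideanSpace ℝ (Fin 3)),
      DefU1 N Γ γ Aa u → DefV1 N α X u v → DefA1 N X c v A → DefT1 N α u T → Clauses1 N Γ δ ρ K Λ a b cnd Rw Rb cg θ₀ γ α X w c m n Aa v A T → ∃ (α₁ C₀ M : ℝ) (U : EuclideanSpace ℝ (Fin 3) → EuclideanSpace ℝ (Fin 3)) (P : EuclideanSpace ℝ (Fin 3) → ℝ), Concl1 N Γ ρ η Rw X u α₁ C₀ M U P

/-- CERTIFICATE that §1 is the crux: the route decl unfolds to the cut form by `Iff.rfl`. -/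
theorem transverseReduction1A_iff : TransverseReduction1A ↔ CutForm1A :=
  Iff.rfl


/-! ## 2. Vocabulary of the line (`lerayOp`, `lerayLin`, `XBound`, `YBound`, `LocClose` are the landed tools of
`Theorems.FilamentSkeletonRssKelvinGateDefs`, opened by name; the only NEW definitions are the rate column and three specs) -/

/-- The RATE COLUMN `𝓡U (y) = e₃ × U(y) − DU(y)[e₃ × y]` — the derivative of the profile operator in the rate:
`lerayOp α′ U y = lerayOp α U y + (α′ − α) • rateGen U y` (by `unfold lerayOp rateGen; module`). -/
def rateGen (U : EuclideanSpace ℝ (Fin 3) → EuclideanSpace ℝ (Fin 3)) (y : EuclideanSpace ℝ (Fin 3)) : EuclideanSpace ℝ (Fin 3) :=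
  cross (EuclideanSpace.single 2 1) (U y) - fderiv ℝ U y (cross (EuclideanSpace.single 2 1) y)

/-- **Spec of S1′ · DRESSED BASE of order `k` at ONE skeleton, with base rate `α⁰`.**  `(α⁰, U⁰, P⁰)`: rate within `θ₀/4` of the
skeleton's, `U⁰` smooth, divergence-free, of polynomial X-size `Cs·Γ⁴` together with its rate column, pressure bounded likewise,
NON-DEGENERATE (`|U⁰(y₀)| ≥ 1` somewhere), `η√Γ/2`-close to the skeleton field `u_X` off the `ρ√Γ/4`-tubes inside the waist ball,
and EXACT residual `E_(α⁰)(U⁰) + ∇P⁰` of Y-size `≤ Cr·Γ^(−k)`.  No multipliers, no modes. -/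
def BaseSpec1 (N : ℕ) (Γ ρ η Rw θ₀ : ℝ) (k : ℕ) (Cs Cr : ℝ) (α : ℝ) (X : Fin N → ℝ → EuclideanSpace ℝ (Fin 3)) (u : (Fin N → ℝ → EuclideanSpace ℝ (Fin 3)) → EuclideanSpace ℝ (Fin 3) → EuclideanSpace ℝ (Fin 3)) (α0 : ℝ) (U0 : EuclideanSpace ℝ (Fin 3) → EuclideanSpace ℝ (Fin 3)) (P0 : EuclideanSpace ℝ (Fin 3) → ℝ) : Prop :=
  |α0 - α| ≤ θ₀ / 4 ∧ ContDiff ℝ (⊤:ℕ∞) U0 ∧ ContDiff ℝ (⊤:ℕ∞) P0 ∧ VectorCalculus.IsDivFree U0 ∧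
  XBound U0 (Cs * Γ ^ 4) ∧ XBound (rateGen U0) (Cs * Γ ^ 4) ∧ (∀ y, |P0 y| ≤ Cs * Γ ^ 4) ∧ (∃ y₀, 1 ≤ ‖U0 y₀‖) ∧
  (∀ y, ‖y‖ ≤ Rw * √Γ → (∀ j τ, ρ * √Γ / 4 ≤ ‖y - X j τ‖) → ‖U0 y - u X y‖ ≤ η * √Γ / 2) ∧
  YBound (fun y => lerayOp α0 U0 y + gradient P0 y) (Cr * Γ ^ (-(k:ℝ)))

/-- **Spec of S2′ · BORDERED (free-rate) KELVIN GATE with polynomial loss.**  For every rate `α′` with `|α′ − α⁰| ≤ θ₀/4`: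
a RIGHT INVERSE `F ↦ (𝓚_α′ F, 𝓠_α′ F, 𝓫_α′ F)` of the bordered linearised profile operator,
`𝓛_(α′,U⁰)(𝓚F) + ∇(𝓠F) + (𝓫F)·𝓡U⁰ = F`, `div 𝓚F = 0`, with `X-size(𝓚F), |𝓠F|, |𝓫F| ≤ C₂ Γ^κ · Y-size(F)`;
(2) linear in `F`; (3) TIGHT, UNIFORMLY IN THE RATE (uniformly Y-bounded forcings small on a large ball give locally small velocity response and
small rate coefficient — the resolvent looks inward along the outward similarity transport, and the rotation cokernel functional is
`⟨y⟩⁻²`-localised); (4) locally continuous in the RATE for fixed data.  (3)+(4) are what make `β ↦ 𝓫_(α⁰+β)(G_β)` continuous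
through the Picard iterates of S3′ although the resolvent is only log-Lipschitz in the rate as a map Y → X. -/
def GateSpec1A (Γ κ C₂ θ₀ : ℝ) (α0 : ℝ) (U0 : EuclideanSpace ℝ (Fin 3) → EuclideanSpace ℝ (Fin 3)) (𝓚 : ℝ → (EuclideanSpace ℝ (Fin 3) → EuclideanSpace ℝ (Fin 3)) → EuclideanSpace ℝ (Fin 3) → EuclideanSpace ℝ (Fin 3)) (𝓠 : ℝ → (EuclideanSpace ℝ (Fin 3) → EuclideanSpace ℝ (Fin 3)) → EuclideanSpace ℝ (Fin 3) → ℝ) (𝓫 : ℝ → (EuclideanSpace ℝ (Fin 3) → EuclideanSpace ℝ (Fin 3)) → ℝ) : Prop :=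
  (∀ α' : ℝ, |α' - α0| ≤ θ₀ / 4 →
    (∀ (F : EuclideanSpace ℝ (Fin 3) → EuclideanSpace ℝ (Fin 3)) (R : ℝ), YBound F R →
        XBound (𝓚 α' F) (C₂ * Γ ^ κ * R) ∧ ContDiff ℝ 1 (𝓠 α' F) ∧ (∀ y, |𝓠 α' F y| ≤ C₂ * Γ ^ κ * R) ∧ |𝓫 α' F| ≤ C₂ * Γ ^ κ * R ∧
        VectorCalculus.IsDivFree (𝓚 α' F) ∧
        ∀ y, lerayLin α' U0 (𝓚 α' F) y + gradient (𝓠 α' F) y + 𝓫 α' F • rateGen U0 y = F y) ∧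
    (∀ (F G : EuclideanSpace ℝ (Fin 3) → EuclideanSpace ℝ (Fin 3)) (s : ℝ), (∃ R, YBound F R) → (∃ R, YBound G R) →
        (𝓚 α' (fun y => F y + s • G y) = fun y => 𝓚 α' F y + s • 𝓚 α' G y) ∧ 𝓫 α' (fun y => F y + s • G y) = 𝓫 α' F + s * 𝓫 α' G)) ∧
  (∀ R L ε : ℝ, 0 < ε → ∃ L' δ₀ : ℝ, 0 < δ₀ ∧ ∀ α' : ℝ, |α' - α0| ≤ θ₀ / 4 →
      ∀ F : EuclideanSpace ℝ (Fin 3) → EuclideanSpace ℝ (Fin 3), YBound F R → (∀ y, ‖y‖ ≤ L' → ‖F y‖ ≤ δ₀) →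
        (∀ y, ‖y‖ ≤ L → ‖𝓚 α' F y‖ ≤ ε ∧ ‖fderiv ℝ (𝓚 α' F) y‖ ≤ ε) ∧ |𝓫 α' F| ≤ ε) ∧
  (∀ α' : ℝ, |α' - α0| ≤ θ₀ / 4 → ∀ (F : EuclideanSpace ℝ (Fin 3) → EuclideanSpace ℝ (Fin 3)) (R L ε : ℝ), YBound F R → 0 < ε →
      ∃ δ' : ℝ, 0 < δ' ∧ ∀ α'' : ℝ, |α'' - α0| ≤ θ₀ / 4 → |α'' - α'| < δ' →
        LocClose (𝓚 α'' F) (𝓚 α' F) L ε ∧ |𝓫 α'' F - 𝓫 α' F| ≤ ε)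

/-- The crux's conclusion block with FINITE regularity (`U ∈ C²`, `P ∈ C¹`): what the fixed point of S3′ delivers before the
landed elliptic smoothing; otherwise VERBATIM `Concl1`. -/
def AlmostConcl1A (N : ℕ) (Γ ρ η Rw : ℝ) (X : Fin N → ℝ → EuclideanSpace ℝ (Fin 3)) (u : (Fin N → ℝ → EuclideanSpace ℝ (Fin 3)) → EuclideanSpace ℝ (Fin 3) → EuclideanSpace ℝ (Fin 3)) (α₁ C₀ M : ℝ) (U : EuclideanSpace ℝ (Fin 3) → EuclideanSpace ℝ (Fin 3)) (P : EuclideanSpace ℝ (Fin 3) → ℝ) : Prop :=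
  α₁ ≠ 0 ∧ U ≠ 0 ∧ ContDiff ℝ 2 U ∧ ContDiff ℝ 1 P ∧ VectorCalculus.IsDivFree U∧(∀ y, α₁•(cross (EuclideanSpace.single 2 1) (U y)-fderiv ℝ U y (cross (EuclideanSpace.single 2 1) y))+(1/2:ℝ)•U y+(1/2:ℝ)•fderiv ℝ U y y-(Laplacian.laplacian U) y+fderiv ℝ U y (U y)+gradient P y = 0)∧(∀ y, ‖U y‖≤C₀/(1+‖y‖))∧(∀ y, |P y|≤M)∧(∀ y, ‖y‖≤Rw*√Γ → (∀ j τ, ρ*√Γ/4≤‖y-X j τ‖) → ‖U y-u X y‖≤η*√Γ)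


/-! ## 3. The three stub STATEMENTS (S1′ dressing · S2′ bordered gate · S3′ rate closing) -/

/-- Statement of stub S1′ · `Dressing1A` (size XL; matched asymptotics with order-by-order rate selection): for every order `k` the
skeleton can be DRESSED into a base of order `k` (spec `BaseSpec1`), size constant `Cs` uniform in `k`. -/
def Dressing1A : Prop :=
  ∀ (N : ℕ) (δ ρ K Λ a b cnd η Rw Rb cg θ₀ : ℝ), 0 < N → 0 < δ → 0 < ρ → 0 ≤ a → 0 < η → 0 < Rw → 0 < Rb → 0 < cg → 0 < θ₀ →
    ∃ Cs : ℝ, ∀ k : ℕ, ∃ Cr Γ₁ : ℝ, ∀ Γ : ℝ, Γ₁ ≤ Γ → ∀ (γ : Fin N → ℝ) (α : ℝ) (X : Fin N → ℝ → EuclideanSpace ℝ (Fin 3)) (w : Fin N → ℝ → ℝ) (c : Fin N → ℝ) (m n : Fin N → EuclideanSpace ℝ (Fin 3)) (Aa : Fin N → ℝ → ℝ) (u : (Fin N → ℝ → EuclideanSpace ℝ (Fin 3)) → EuclideanSpace ℝ (Fin 3) → EuclideanSpace ℝ (Fin 3)) (v : EuclideanSpace ℝ (Fin 3) → EuclideanSpace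 ℝ (Fin 3)) (A : Fin N → (EuclideanSpace ℝ (Fin 3) →L[ℝ] EuclideanSpace ℝ (Fin 3))) (T : (Fin N → ℝ → EuclideanSpace ℝ (Fin 3)) → Fin N → ℝ → EuclideanSpace ℝ (Fin 3)),
      DefU1 N Γ γ Aa u → DefV1 N α X u v → DefA1 N X c v A → DefT1 N α u T → Clauses1 N Γ δ ρ K Λ a b cnd Rw Rb cg θ₀ γ α X w c m n Aa v A T →
      ∃ (α0 : ℝ) (U0 : EuclideanSpace ℝ (Fin 3) → EuclideanSpace ℝ (Fin 3)) (P0 : EuclideanSpace ℝ (Fin 3) → ℝ), BaseSpec1 N Γ ρ η Rw θ₀ k Cs Cr α X u α0 U0 P0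

/-- Statement of stub S2′ · `BorderedGate1A` (size XL; KILL-FIRST, HARDEST): around EVERY dressed base of any sufficiently high
order `k ≥ k₀` and size `Cs` there is a bordered free-rate gate (spec `GateSpec1A`) with exponent `κ` and constant `C₂` depending on
the box constants and `Cs` only — not on `Γ`, the skeleton, the base, or `k`. -/
def BorderedGate1A : Prop :=
  ∀ (N : ℕ) (δ ρ K Λ a b cnd η Rw Rb cg θ₀ : ℝ), 0 < N → 0 < δ → 0 < ρ → 0 ≤ a → 0 < η → 0 < Rw → 0 < Rb → 0 < cg → 0 < θ₀ →
    ∀ Cs : ℝ, ∃ κ C₂ : ℝ, ∃ k₀ : ℕ, ∀ k : ℕ, k₀ ≤ k → 1 ≤ k → ∀ Cr : ℝ, ∃ Γ₁ : ℝ, ∀ Γ : ℝ, Γ₁ ≤ Γ → ∀ (γ : Fin N → ℝ) (α : ℝ) (X : Fin N → ℝ → EuclideanSpace ℝ (Fin 3)) (w : Fin N → ℝ → ℝ) (c : Fin N → ℝ) (m n : Fin N → EuclideanSpace ℝ (Fin 3)) (Aa : Fin N → ℝ → ℝ) (u : (Fin N → ℝ → EuclideanSpace ℝ (Fin 3)) →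 EuclideanSpace ℝ (Fin 3) → EuclideanSpace ℝ (Fin 3)) (v : EuclideanSpace ℝ (Fin 3) → EuclideanSpace ℝ (Fin 3)) (A : Fin N → (EuclideanSpace ℝ (Fin 3) →L[ℝ] EuclideanSpace ℝ (Fin 3))) (T : (Fin N → ℝ → EuclideanSpace ℝ (Fin 3)) → Fin N → ℝ → EuclideanSpace ℝ (Fin 3)),
      DefU1 N Γ γ Aa u → DefV1 N α X u v → DefA1 N X c v A → DefT1 N α u T → Clauses1 N Γ δ ρ K Λ a b cnd Rw Rb cg θ₀ γ α X w c m n Aa v A T →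
      ∀ (α0 : ℝ) (U0 : EuclideanSpace ℝ (Fin 3) → EuclideanSpace ℝ (Fin 3)) (P0 : EuclideanSpace ℝ (Fin 3) → ℝ), BaseSpec1 N Γ ρ η Rw θ₀ k Cs Cr α X u α0 U0 P0 →
      ∃ (𝓚 : ℝ → (EuclideanSpace ℝ (Fin 3) → EuclideanSpace ℝ (Fin 3)) → EuclideanSpace ℝ (Fin 3) → EuclideanSpace ℝ (Fin 3)) (𝓠 : ℝ → (EuclideanSpace ℝ (Fin 3) → EuclideanSpace ℝ (Fin 3)) → EuclideanSpace ℝ (Fin 3) → ℝ) (𝓫 : ℝ → (EuclideanSpace ℝ (Fin 3) → EuclideanSpace ℝ (Fin 3)) → ℝ), GateSpec1A Γ κ C₂ θ₀ α0 U0 𝓚 𝓠 𝓫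

/-- Statement of stub S3′ · `RateClosing1A` (size L; frozen-rate contraction + one-dimensional rate selection + bookkeeping): given
the gate's `κ, C₂`, the size `Cs` and ANY threshold `k₀`, SOME dressing order `k ≥ k₀` suffices: for every dressed base of that order and
every bordered gate around it, for `Γ ≥ Γ₁` there are `β` with `|β| ≤ θ₀/4` and a fixed point `G_β = −r − D(𝓚_(α⁰+β) G_β)[𝓚_(α⁰+β) G_β]`
with `β = 𝓫_(α⁰+β) G_β`, whence `α₁ = α⁰ + β ≠ 0`, `U = U⁰ + 𝓚G`, `P = P⁰ + 𝓠G` satisfy the crux's conclusion with `C²/C¹` regularity. -/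
def RateClosing1A : Prop :=
  ∀ (N : ℕ) (δ ρ K Λ a b cnd η Rw Rb cg θ₀ : ℝ), 0 < N → 0 < δ → 0 < ρ → 0 ≤ a → 0 < η → 0 < Rw → 0 < Rb → 0 < cg → 0 < θ₀ →
    ∀ Cs κ C₂ : ℝ, ∀ k₀ : ℕ, ∃ k : ℕ, k₀ ≤ k ∧ 1 ≤ k ∧ ∀ Cr : ℝ, ∃ Γ₁ : ℝ, ∀ Γ : ℝ, Γ₁ ≤ Γ → ∀ (γ : Fin N → ℝ) (α : ℝ) (X : Fin N → ℝ → EuclideanSpace ℝ (Fin 3)) (w : Fin N → ℝ → ℝ) (c : Fin N → ℝ) (m n : Fin N → EuclideanSpace ℝ (Fin 3)) (Aa : Fin N → ℝ → ℝ) (u : (Fin N → ℝ → EuclideanSpace ℝ (Fin 3)) → EuclideanSpace ℝ (Fin 3) → EuclideanSpace ℝ (Fin 3)) (v : EuclideanSpace ℝ (Fin 3) → EuclideanSpace ℝ (Fin 3)) (A : Fin N → (EuclideanSpace ℝ (Fin 3) →L[ℝ] EuclideanSpace ℝ (Fin 3))) (T : (Fin N → ℝ → EuclideanSpace ℝ (Fin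 3)) → Fin N → ℝ → EuclideanSpace ℝ (Fin 3)),
      DefU1 N Γ γ Aa u → DefV1 N α X u v → DefA1 N X c v A → DefT1 N α u T → Clauses1 N Γ δ ρ K Λ a b cnd Rw Rb cg θ₀ γ α X w c m n Aa v A T →
      ∀ (α0 : ℝ) (U0 : EuclideanSpace ℝ (Fin 3) → EuclideanSpace ℝ (Fin 3)) (P0 : EuclideanSpace ℝ (Fin 3) → ℝ), BaseSpec1 N Γ ρ η Rw θ₀ k Cs Cr α X u α0 U0 P0 →
      ∀ (𝓚 : ℝ → (EuclideanSpace ℝ (Fin 3) → EuclideanSpace ℝ (Fin 3)) → EuclideanSpace ℝ (Fin 3) → EuclideanSpace ℝ (Fin 3)) (𝓠 : ℝ → (EuclideanSpace ℝ (Fin 3) → EuclideanSpace ℝ (Fin 3)) → EuclideanSpace ℝ (Fin 3) → ℝ) (𝓫 : ℝ → (EuclideanSpace ℝ (Fin 3) → EuclideanSpace ℝ (Fin 3)) → ℝ), GateSpec1A Γ κ C₂ θ₀ α0 U0 𝓚 𝓠 𝓫 →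
      ∃ (α₁ C₀ M : ℝ) (U : EuclideanSpace ℝ (Fin 3) → EuclideanSpace ℝ (Fin 3)) (P : EuclideanSpace ℝ (Fin 3) → ℝ), AlmostConcl1A N Γ ρ η Rw X u α₁ C₀ M U P


/-! ## 4. Registered stubs and the kernel-checked composition -/

/-- **Stub S1′** (`Dressing1A`). -/
theorem stub_dressing1A : Dressing1A := by
  sorry

/-- **Stub S2′** (`BorderedGate1A`) — KILL-FIRST. -/
theorem stub_borderedGate1A : BorderedGate1A := by
  sorry

/-- **Stub S3′** (`RateClosing1A`). -/
theorem stub_rateClosing1A : RateClosing1A := by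
  sorry

/-- **Composition (pure logic + the LANDED smoothing ladder, no sorry).**  Dressing + bordered gate + rate closing give
`TransverseReduction1A` BY NAME: constants in the order `Cs` (S1′) → `κ, C₂, k₀` (S2′) → `k ≥ k₀` (S3′) → `Cr` (S1′ at `k`) → the three
thresholds → `Γ₁ = max`; `C²/C¹ ⇒ C^∞` by `Theorems.KelvinGate.Smoothing.contDiff_velocity_infty / contDiff_pressure_infty` with `F = 0`. -/
theorem lineGlue1A (h1 : Dressing1A) (h2 : BorderedGate1A) (h3 : RateClosing1A) : CutForm1A := by
  intro N δ ρ K Λ a b cnd η Rw Rb cg θ₀ hN hδ hρ ha hη hRw hRb hcg hθ₀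
  obtain ⟨Cs, hS1⟩ := h1 N δ ρ K Λ a b cnd η Rw Rb cg θ₀ hN hδ hρ ha hη hRw hRb hcg hθ₀
  obtain ⟨κ, C₂, k₀, hS2⟩ := h2 N δ ρ K Λ a b cnd η Rw Rb cg θ₀ hN hδ hρ ha hη hRw hRb hcg hθ₀ Cs
  obtain ⟨k, hk₀, hk, hS3⟩ := h3 N δ ρ K Λ a b cnd η Rw Rb cg θ₀ hN hδ hρ ha hη hRw hRb hcg hθ₀ Cs κ C₂ k₀
  obtain ⟨Cr, Γa, hS1'⟩ := hS1 k
  obtain ⟨Γb, hS2'⟩ := hS2 k hk₀ hk Cr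
  obtain ⟨Γc, hS3'⟩ := hS3 Cr
  refine ⟨max Γa (max Γb Γc), ?_⟩
  intro Γ hΓ γ α X w c m n Aa u v A T hu hv hA hT hcl
  have hΓa : Γa ≤ Γ := le_trans (le_max_left _ _) hΓ
  have hΓb : Γb ≤ Γ := le_trans (le_trans (le_max_left _ _) (le_max_right _ _)) hΓ
  have hΓc : Γc ≤ Γ := le_trans (le_trans (le_max_right _ _) (le_max_right _ _)) hΓ
  obtain ⟨α0, U0, P0, hbase⟩ := hS1' Γ hΓa γ α X w c m n Aa u v A T hu hv hA hT hcl
  obtain ⟨𝓚, 𝓠, 𝓫, hgate⟩ := hS2' Γ hΓb γ α X w c m n Aa u v A T hu hv hA hT hcl α0 U0 P0 hbase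
  obtain ⟨α₁, C₀, M, U, P, hU⟩ := hS3' Γ hΓc γ α X w c m n Aa u v A T hu hv hA hT hcl α0 U0 P0 hbase 𝓚 𝓠 𝓫 hgate
  obtain ⟨hα₁, hne, hU2, hP1, hdiv, heq, hdec, hPM, hwin⟩ := hU
  have hF : ContDiff ℝ ∞ (fun _ : EuclideanSpace ℝ (Fin 3) => (0 : EuclideanSpace ℝ (Fin 3))) := contDiff_const
  have hUs : ContDiff ℝ ∞ U :=
    Theorems.KelvinGate.Smoothing.contDiff_velocity_infty (F := fun _ => 0) hU2 hdiv hP1 hF heq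
  have hPs : ContDiff ℝ ∞ P :=
    Theorems.KelvinGate.Smoothing.contDiff_pressure_infty (F := fun _ => 0) hU2 hdiv hP1 hF heq
  exact ⟨α₁, C₀, M, U, P, hα₁, hne, hUs, hPs, hdiv, heq, hdec, hPM, hwin⟩

/-- **The skeleton (A12 shape): the crux BY NAME from the three registered stubs**, via the sorry-free glue `lineGlue1A` and the
`Iff.rfl` certificate — the audit shows exactly which sorries (`stub_*`) the line rests on. -/
theorem TransverseReduction1A_of : TransverseReduction1A :=
  transverseReduction1A_iff.mpr (lineGlue1A stub_dressing1A stub_borderedGate1A stub_rateClosing1A)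

/-- Sanity identity recorded for S3′: the profile operator is affine in the rate with slope the rate column. -/
theorem lerayOp_rate_shift (α α' : ℝ) (U : EuclideanSpace ℝ (Fin 3) → EuclideanSpace ℝ (Fin 3)) (y : EuclideanSpace ℝ (Fin 3)) :
    lerayOp α' U y = lerayOp α U y + (α' - α) • rateGen U y := by
  unfold lerayOp rateGen
  module

end Summit.NavierStokesRegularity.NavierStokesRegularity.Cruxes.TransverseReduction1A.FreeRateGate
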